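import Summits.QuantumFields.BalabanUV.Beta.FP.LegPairingRemainder
import Summits.QuantumFields.BalabanUV.Beta.D1BFx.DressedTablesLeg

/-!
# `BalabanUV.Beta.FP.LegPairingGerm` — THE LEGS GERM OF THE FINE BUBBLE TABLE: `|a·𝔅_b(w) − Σ_i cc₀ i·F′ b i w·G′ b i w| ≤ D/(‖w‖∞+2)⁷` for
# `𝔅_b(w) = bubbleTableA A S μ ν (b+w) b` over a GRADED leg `A` and bi-localised stencils `S`, and the `hlegs` binder family it yields
# (road «FP», LEGS generic track, module (R) part 3 = the instance at road BF-x ∕ FP's fine bubble table; [folklore], `ℤ⁴`)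

HONEST DEPENDENCY (page 1, mandatory): continuum YM on T⁴ ⇐ BetaPertH ∧ nine spine estimates (0/9 proved); BetaPertH ⇐ (D1) ∧ (D4) ∧
CAP+tail; G-an2-4 gates asym, D1 and NE2/3/4.  HONEST FRAMING (cell contract, verbatim): «discharging `BetaPertH` makes Bałaban's UV
stability UNCONDITIONAL — a real constructive-QFT result; it is NOT the continuum limit and NOT the Clay problem.»  THIS MODULE composes BY NAME
`FP/LegPairingRemainder.abs_bubble_sub_table_le_basePoint` (this seat) with d1-leaf-01's `D1BFx/DressedTablesLeg.bubbleTableA` (`= −½·bubble A (S κ′ u) (S λ′ u′)`),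
d1-p2's `MomentTransferPeriodic.baseKer` (`baseKer P b w = P (b+w) b`) and asym1's `FP/LegsShellBound.hlegs_family_of_germWindow`.  It cites nothing, mints no
`Prop` fact, 0 sorry; its two `def`s (`legF`, `legG`: the smeared one-sided difference legs of the table, indexed by `LIdx F = F × F × Idx 4 × Idx 4`) are data.
The GRADED bounds on the leg (`|A(x,y)| ≤ C/(‖x−y‖∞+1)²`, third coordinate differences `≤ C/(‖x−y‖∞+1)⁵`) and the stencils' bi-localisation are HYPOTHESES
(road FP: rows MS-3∕4 and the `LocStencil` class data of the perfect stencils — not here); the TADPOLE half of `fineHessA` is a CONTACT term (row N7d-T,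
`FP/PerfectContact`) and is not touched.  NOT the `Leg` structure ∕ `hdeg` of the table legs (rows (W)(L)), NOT `hrep`, NOT D1, NOT BetaPertH, NOT continuum, NOT Clay.

CONTENT.  §1 `LIdx`, `legF`, `legG`, `table_eq_sum_LIdx` (the four-fold finite table of `LegPairingRemainder` as ONE sum over `LIdx F`);
§2 `germ_bubbleTableA : |a·baseKer (bubbleTableA A S μ ν) b w − Σ_{i : LIdx F} (−½a)·(legF … i w·legG … i w)| ≤ (|a|/2·|F|²·remConst·Zl(δ/2)²)/(‖w‖∞+2)⁷`
for EVERY base point `b` and offset `w`; §3 `hlegs_family_bubbleTableA`: in the currency `Φ b w = a·(w_μ w_ν·baseKer (bubbleTableA A S μ ν) b w)` the `hlegs`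
binder family of `RepAssembly.hrep_of_basePoint{,_uniform,_nUniform}` holds for EVERY `Bset`, `R₀` with `s := univ`, `cc₀ := −½a`, `F′ := legF`, `G′ := legG` and
`U₁ := 160·(|a|/2·|F|²·remConst·Zl(δ/2)²)` — `n`-free as soon as `(a·C², C_S, δ)` are.
Unit `b2b-balaban-beta-d1-formalise-leaf-02` (gen 5).
-/

noncomputable section

namespace Summit.QuantumFields.BalabanUV.Beta.FP.LegPairingGerm

open Finset fwdDiff
open scoped BigOperators
open Literature.MathematicalPhysics.QuantumFieldTheory.Balaban1983to89
open Literature.MathematicalPhysics.QuantumFieldTheory.Balaban1983to89.Beta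
open ExpKernelCalculus (Site MKer BiLoc comp tr bubble Zl Zl_pos)
open Literature.Probability.LatticeModels (annulus)
open DyadicShell (Pt supNorm toReal)
open WindowIdentification (psum)
open Summit.QuantumFields.BalabanUV.Beta.D1BFx.MomentTransferPeriodic (baseKer)
open Summit.QuantumFields.BalabanUV.Beta.D1BFx.DressedTablesLeg (bubbleTableA bubbleTableA_apply)
open Summit.QuantumFields.BalabanUV.Beta.FP.LatticeTaylorIndex (Idx)
open Summit.QuantumFields.BalabanUV.Beta.FP.LegPairing (sLeg)
open Summit.QuantumFields.BalabanUV.Beta.FP.LegPairingRemainder (remConst remConst_nonneg abs_bubble_sub_table_le_basePoint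
  div_supNorm_add_two_pow_le)

variable {F : Type*} [Fintype F]

/-! ## §1 The table as one finite sum over `LIdx F = F × F × Idx 4 × Idx 4` -/

/-- [folklore] The LEGS index of the fine bubble table: fibre × fibre × difference word × difference word. -/
abbrev LIdx (F : Type*) : Type _ := F × F × Idx 4 × Idx 4

/-- [folklore] THE FIRST TABLE LEG at base point `b`, index `i = (a, c, ι, κ)`, offset `w`: the `κ`-smeared `ι`-difference leg of `A` against the stencil
`S μ (b+w)` — `sLeg ι κ A (S μ (b+w)) b (b+w) a c`. -/
def legF (A : MKer 4 F) (S : Fin 4 → Pt → MKer 4 F) (μ : Fin 4) (b : Pt) (i : LIdx F) (w : Pt) : ℝ :=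
  sLeg i.2.2.1 i.2.2.2 A (S μ (b + w)) b (b + w) i.1 i.2.1

/-- [folklore] THE SECOND TABLE LEG: `sLeg κ ι A (S ν b) (b+w) b c a`. -/
def legG (A : MKer 4 F) (S : Fin 4 → Pt → MKer 4 F) (ν : Fin 4) (b : Pt) (i : LIdx F) (w : Pt) : ℝ :=
  sLeg i.2.2.2 i.2.2.1 A (S ν b) (b + w) b i.2.1 i.1

/-- [folklore] The four-fold finite table of `LegPairingRemainder.abs_bubble_sub_table_le_basePoint` IS `Σ_{i : LIdx F} legF i w · legG i w`. -/
theorem table_eq_sum_LIdx (A : MKer 4 F) (S : Fin 4 → Pt → MKer 4 F) (μ ν : Fin 4) (b w : Pt) :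
    ∑ a : F, ∑ c : F, ∑ ι : Idx 4, ∑ κ : Idx 4, sLeg ι κ A (S μ (b + w)) b (b + w) a c * sLeg κ ι A (S ν b) (b + w) b c a
      = ∑ i : LIdx F, legF A S μ b i w * legG A S ν b i w := by
  simp only [LIdx, legF, legG, Fintype.sum_prod_type]

/-! ## §2 The septic germ of the fine bubble table -/

section Germ

variable {A : MKer 4 F} {S : Fin 4 → Pt → MKer 4 F} {C Cs δ : ℝ}

/-- **THE LEGS GERM OF THE FINE BUBBLE TABLE**: for a leg `A` with graded bounds of order 0 and 3 and stencils `S κ u` bi-localised at `(u, u)` (rate `δ > 0`),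
`|a·baseKer (bubbleTableA A S μ ν) b w − Σ_{i : LIdx F} (−½a)·(legF A S μ b i w · legG A S ν b i w)| ≤ (|a|/2·|F|²·remConst·Zl(δ/2)²)/(‖w‖∞+2)⁷` for every base
point `b` and offset `w`. [folklore] -/
theorem germ_bubbleTableA (hC : 0 ≤ C) (hδ : 0 < δ) (h0 : ∀ (x y : Pt) (a b : F), |A x y a b| ≤ C / ((supNorm (x - y) : ℝ) + 1) ^ 2)
    (h3 : ∀ (i j k : Fin 4) (x y : Pt) (a b : F),
      |Δ_[(Pi.single i 1 : Pt)] (Δ_[(Pi.single j 1 : Pt)] (Δ_[(Pi.single k 1 : Pt)] fun x' => A x' y a b)) x| ≤ C / ((supNorm (x - y) : ℝ) + 1) ^ 5)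
    (hS : ∀ (κ : Fin 4) (u : Pt), BiLoc (S κ u) u u Cs δ) (a : ℝ) (μ ν : Fin 4) (b w : Pt) :
    |a * baseKer (bubbleTableA A S μ ν) b w - ∑ i : LIdx F, (-(1 / 2 : ℝ) * a) * (legF A S μ b i w * legG A S ν b i w)|
      ≤ (|a| / 2 * ((Fintype.card F : ℝ) ^ 2 * remConst (Fintype.card F) C Cs Cs δ * Zl 4 (δ / 2) ^ 2)) / ((supNorm w : ℝ) + 2) ^ 7 := by
  have h := abs_bubble_sub_table_le_basePoint hC hδ h0 h3 (V := fun w => S μ (b + w)) (W₀ := S ν b) (b := b) (fun w => hS μ (b + w)) (hS ν b) w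
  rw [← mul_sum, ← table_eq_sum_LIdx, baseKer, bubbleTableA_apply]
  rw [show a * (-(1 / 2 : ℝ) * bubble A (S μ (b + w)) (S ν b))
      - -(1 / 2 : ℝ) * a * ∑ a' : F, ∑ c : F, ∑ ι : Idx 4, ∑ κ : Idx 4, sLeg ι κ A (S μ (b + w)) b (b + w) a' c * sLeg κ ι A (S ν b) (b + w) b c a'
      = (-(1 / 2 : ℝ) * a) * (bubble A (S μ (b + w)) (S ν b)
          - ∑ a' : F, ∑ c : F, ∑ ι : Idx 4, ∑ κ : Idx 4, sLeg ι κ A (S μ (b + w)) b (b + w) a' c * sLeg κ ι A (S ν b) (b + w) b c a') by ring,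
    abs_mul, show |(-(1 / 2 : ℝ) * a)| = |a| / 2 by rw [abs_mul, abs_neg, abs_of_pos (by norm_num : (0 : ℝ) < 1 / 2)]; ring, mul_div_assoc]
  exact mul_le_mul_of_nonneg_left h (by positivity)

/-- [folklore] The germ constant is nonnegative. -/
theorem germConst_nonneg (hC : 0 ≤ C) (hCs : 0 ≤ Cs) (hδ : 0 < δ) (a : ℝ) :
    0 ≤ |a| / 2 * ((Fintype.card F : ℝ) ^ 2 * remConst (Fintype.card F) C Cs Cs δ * Zl 4 (δ / 2) ^ 2) := by
  have := remConst_nonneg (Fintype.card F) hC hCs hCs hδ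
  have hZ : (0 : ℝ) ≤ Zl 4 (δ / 2) := (Zl_pos (show (0 : ℝ) < δ / 2 by positivity)).le
  positivity

end Germ

/-! ## §3 The `hlegs` binder family of `RepAssembly.hrep_of_basePoint*` for the fine bubble table -/

section Family

variable {A : MKer 4 F} {S : Fin 4 → Pt → MKer 4 F} {C Cs δ : ℝ} [Nonempty F]

/-- **THE `hlegs` BINDER FAMILY FOR THE FINE BUBBLE TABLE, LITERALLY** (BY NAME through `LegsShellBound.hlegs_family_of_germWindow`): in the base-point currency
`Φ b w = a·(w_μ·w_ν·baseKer (bubbleTableA A S μ ν) b w)`, for EVERY finite set of base points `Bset` and EVERY window radius `R₀`,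
`∀ b ∈ Bset, |psum (Φ b) R₀ − Σ_{w ∈ annulus 4 0 R₀} w_μ·w_ν·Σ_{i ∈ univ} (−½a)·(legF A S μ b i w·legG A S ν b i w)| ≤ 160·(|a|/2·|F|²·remConst·Zl(δ/2)²)` — the window
constant `U₁` is free of `Bset`, `R₀` and of the base point. [folklore] -/
theorem hlegs_family_bubbleTableA (hC : 0 ≤ C) (hδ : 0 < δ) (h0 : ∀ (x y : Pt) (a b : F), |A x y a b| ≤ C / ((supNorm (x - y) : ℝ) + 1) ^ 2)
    (h3 : ∀ (i j k : Fin 4) (x y : Pt) (a b : F),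
      |Δ_[(Pi.single i 1 : Pt)] (Δ_[(Pi.single j 1 : Pt)] (Δ_[(Pi.single k 1 : Pt)] fun x' => A x' y a b)) x| ≤ C / ((supNorm (x - y) : ℝ) + 1) ^ 5)
    (hS : ∀ (κ : Fin 4) (u : Pt), BiLoc (S κ u) u u Cs δ) (a : ℝ) (μ ν : Fin 4) {Bset : Finset Pt} {Φ : Pt → Pt → ℝ}
    (hΦ : ∀ b ∈ Bset, ∀ w, Φ b w = a * (toReal w μ * toReal w ν * baseKer (bubbleTableA A S μ ν) b w)) (R₀ : ℕ) :
    ∀ b ∈ Bset, |psum (Φ b) R₀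
        - ∑ w ∈ annulus 4 0 R₀, toReal w μ * toReal w ν
            * ∑ i ∈ (univ : Finset (LIdx F)), (-(1 / 2 : ℝ) * a) * (legF A S μ b i w * legG A S ν b i w)|
      ≤ 160 * (|a| / 2 * ((Fintype.card F : ℝ) ^ 2 * remConst (Fintype.card F) C Cs Cs δ * Zl 4 (δ / 2) ^ 2)) := by
  have hCs : 0 ≤ Cs := (hS 0 0).nonneg (Classical.arbitrary F)
  have hD := germConst_nonneg (F := F) hC hCs hδ a
  exact LegsShellBound.hlegs_family_of_germWindow hΦ hD fun b _ r _ w hw =>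
    (germ_bubbleTableA hC hδ h0 h3 hS a μ ν b w).trans (div_supNorm_add_two_pow_le hD hw)

end Family

end Summit.QuantumFields.BalabanUV.Beta.FP.LegPairingGerm

end
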